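import Summits.AtomisticToContinuum.BoseEinsteinCondensation.Theses.BECDispersionLadder
import Literature.MathematicalPhysics.QuantumManyBody.PeriodicBoseGasFracEnergy

/-!
# Route BECDispersionLadder — support item `OccupationSumRule`

The plane-wave occupations of a periodic trial state on the torus of side `L > 0` sum to the
particle number: `∑_{p ∈ ℤ³} n_Ψ(p) = N` (Parseval in the traced variable, `tr γ_Ψ = N`).
This is `PeriodicTrialState.tsum_cellOccupation_planeWaveMode` of
`Literature/MathematicalPhysics/QuantumManyBody/PeriodicBoseGasFracEnergy.lean`; the plane wave
inlined in the route decl is `planeWaveMode L p` by definition.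
-/

namespace Summit.AtomisticToContinuum.BoseEinsteinCondensation.Theorems

open Literature.MathematicalPhysics.QuantumManyBody.BoseGas

/-- **Occupation sum rule** (item stmt-AtomisticToContinuum-14559, route BECDispersionLadder):
for every `N`, every `L > 0` and every periodic trial state `Ψ` on the torus of side `L`, the
plane-wave occupations `n_Ψ(p) = ⟨φ_p, γ_Ψ φ_p⟩`, `φ_p = L^{-3/2} e^{2πi p·x/L}`, sum to `N`
(Parseval on the cell in the traced variable, then `‖Ψ‖ = 1`). -/
theorem occupationSumRule_proof :
    Summit.AtomisticToContinuum.BoseEinsteinCondensation.Theses.BECDispersionLadder.OccupationSumRule := by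
  unfold Summit.AtomisticToContinuum.BoseEinsteinCondensation.Theses.BECDispersionLadder.OccupationSumRule
  intro N L hL Ψ
  exact Ψ.tsum_cellOccupation_planeWaveMode hL

end Summit.AtomisticToContinuum.BoseEinsteinCondensation.Theorems
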